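/-
Copyright (c) 2026 the pub-hodgecm-mathlib formalisation cell (harness21).  Prover seats hodgecm-mathlib-F0P2-p02 (g11) (LEG by paste, 2026-09-01) and (g12) (this file).  Road «S3-tree»
(architect A-p16 (g30) A-85 (4) ∕ A-88 (1)), the two waypoint heads `…_le_one` ∕ `…_le_two` for EVERY hermitian form along a local similitude.
-/
import Literature.NumberTheory.Rogawski1990.LocalTransferAtOneHyperspecialLevelOne      -- ★ END F0P3a-p03 (g16): `localTransferAtOne_of_hyperspecialLevel_le_one`
import Literature.NumberTheory.Rogawski1990.LocalTransferAtOneHyperspecialLevelTwo      -- ★ END F0P3a-p03 (g16): `localTransferAtOne_of_hyperspecialLevel_le_two`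
import Literature.NumberTheory.Rogawski1990.FinExplicitTransferFactorFormTransport     -- ★ p846358 (F0P2-p02 (g11)): §5 `localTransferAtOne_transport_of_formCongr`
import Literature.NumberTheory.Rogawski1990.LocalTransferTransportCanonical          -- ★ `transport_isCanonical_isRegularElt`, `OrbitalMeasureFamily.IsCanonical.transport`
import Literature.NumberTheory.Automorphic.UnitaryGroupOrbitalMeasureOfLocalQuotient  -- ★ `isMulRightInvariant_map_mulEquiv_of_isMulRightInvariant`
import Literature.NumberTheory.Automorphic.LocalUnitaryIntegralLevel                -- ★ `isUnit_placeForm_antidiagOne`, `unit_placeForm_antidiagOne_mem_glInt`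
import HarnessLib

/-!
# The waypoint heads `localTransferAtOne_of_hyperspecialLevel_le_one ∕ _le_two` FOR EVERY hermitian `H′` along a local similitude (bad reduction included)

Topic `NumberTheory/Rogawski1990`; namespace `Literature.NumberTheory.Rogawski1990`.  THEOREMS ONLY (no definition, no instance, no notation, no named fact, no `sorry`); kernel lane
`--supports stmt-HodgeConjecture-24833`.  Cell `pub/hodgecm-mathlib` (D-0151), crux H413; road «S3-tree» (architect A-p16 (g30) A-85 (4) ∕ A-88 (1): «the head for every `H′`»;
«S3-res» census `F0/P3a/F0P3a-p06/g15/CENSUS-S3res-placeGenericity.F0P3a-p06g15.md` §0: «★ p846358 drops the frame pair (modulo (H2))»).  This file is the LEG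
`F0/P2/p02/g11/LEG-LocalTransferAtOneHyperspecialOfFormTransport.le_one.bypaste.F0P2p02g11.lean` (6b8df306, GREEN over the pasted head) made real over the ★ heads of END
F0P3a-p03 (g16) (`LocalTransferAtOneHyperspecialLevelOne∕Two`), plus its level-2 twin.  HONEST LABEL: HC_CM is proved only modulo the 2 remaining named inputs (hLiu418 24832,
h413 24833) until rung 0 closes; nothing printed is asserted here.

THE MATHEMATICS.  `v` a non-split place of `L⁺` (`σ • w = w`) unramified in `L`, `v ∤ 2`; `H′ ∈ M₃(L)` hermitian with `det H′ ≠ 0` — NO good-reduction hypothesis at `w`; `(T, a)` a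
local similitude `ᵗ(σT)·H′_v·T = a·Φ₃,v` over `E_v = ∏_{w∣v} L_w` with `a ∈ E_v^×` `σ`-fixed (for `L_w∕K_v` unramified and odd rank one always exists: organ (H2), F0P2-p01 (g14));
`e := cmDatumLocalCongr L v T ha h : U(Φ₃)_v ≃ₜ* U(H′)_v` (conjugation by `T`).  For a piece `g ∈ C_c^∞(U(H′)_v)` supported in the hyperspecial `e(K_std(Φ₃))`, `Ad e(K_std)`-invariant
and left-invariant under `e` of the level-`j` congruence set (`j = 1, 2`), the head's conclusion holds VERBATIM: near `1 ∈ H_v` the `Δ‴`-weighted orbital sum of `g` is a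
`C_c^∞` stable orbital integral.  Proof: the ★ head at `Φ₃` — good reduction at EVERY `w` (★ `isUnit_placeForm_antidiagOne`, ★ `unit_placeForm_antidiagOne_mem_glInt`) — for the
transported data `(e⁻¹_* ν_G, e⁻¹_* m_G, g ∘ e)` (the canonical family transports: ★ `OrbitalMeasureFamily.IsCanonical.transport`, regularity is a class invariant), then ★
`localTransferAtOne_transport_of_formCongr` (p846358: `Δ‴` and the orbital sums are invariant under `e`, up to the sign `χ(a) = ±1` absorbed into `φ_H`).

* `localTransferAtOne_of_hyperspecialLevel_le_one_of_formCongr` (level `j = 1`), `localTransferAtOne_of_hyperspecialLevel_le_two_of_formCongr` (level `j = 2`).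

## References
* [Rogawski1990] J. D. Rogawski, *Automorphic Representations of Unitary Groups in Three Variables*, Ann. of Math. Stud. 123 (1990), §4.9 Prop. 4.9.1 p. 55; §14.2 p. 232; §14.4
  p. 237.
* [LanglandsShelstad1987] R. P. Langlands, D. Shelstad, *On the definition of transfer factors*, Math. Ann. 278 (1987), §4.2 (transfer factors under inner twists).
* [Jacobowitz1962] R. Jacobowitz, *Hermitian forms over local fields*, Amer. J. Math. 84 (1962), §3 (classification over an unramified quadratic extension).
-/
set_option autoImplicit false

noncomputable section

open NumberField IsDedekindDomain MeasureTheory Measure Topology Filter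
open Literature.NumberTheory.Rogawski1990 Literature.NumberTheory.Automorphic Literature.NumberTheory.GaloisRepresentations
open Literature.NumberTheory.Automorphic.UnitaryGroup Literature.NumberTheory.Automorphic.IntegralReduction
open Literature.AlgebraicGeometry.ShimuraVarieties (unitaryGroup hermForm)
open scoped Matrix MatrixGroups Classical ValuativeRel

namespace Literature.NumberTheory.Rogawski1990


/-- **COROLLARY (A-85 (4) ∕ A-88 (1)): the waypoint head `…_le_one` HOLDS FOR EVERY `H′` at an unramified non-split `v ∤ 2` — bad reduction at `w` included —
for pieces on the hyperspecial `e(K_std(Φ₃))`**, `e = cmDatumLocalCongr … : U(Φ₃)_v ≃ₜ* U(H′)_v` the conjugation by a local similitude `ᵗ(σT)·H′_v·T = a·Φ₃,v` (★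
`exists_formCongr_map_eq_smul_antidiag_of_smul_eq`): the good-reduction pair `hH′w hH′i` of the head is DROPPED (replaced by `hdet`), the piece hypotheses are the head's
pulled back through `e`, the conclusion is the head's VERBATIM.  Proof: the head at `Φ₃` (good reduction at every `w`: ★ `isUnit_placeForm_antidiagOne`, ★
`unit_placeForm_antidiagOne_mem_glInt`) for the transported data `(e⁻¹_* ν_G, e⁻¹_* m_G, g ∘ e)` (canonical: ★ `transport_isCanonical_isRegularElt`), then ★
`localTransferAtOne_transport_of_formCongr`. [cite: Rogawski1990, §4.9 Prop. 4.9.1 p. 55; §14.4 p. 237] [cite: LanglandsShelstad1987, §4.2] -/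
theorem localTransferAtOne_of_hyperspecialLevel_le_one_of_formCongr
    (L : Type) [Field L] [NumberField L] [IsCMField L] (H' : Matrix (Fin 3) (Fin 3) L) (μ : HeckeCharacter L)
    {v : HeightOneSpectrum (𝓞 ↥(maximalRealSubfield L))}
    (hH' : (H'.map (cmConjRingHom L)).transpose = H') (hdet : H'.det ≠ 0) (w : PlacesOver L v)
    (hw : IsCMField.complexConj L • w.1 = w.1) (hv : Algebra.IsUnramifiedIn (𝓞 L) v.asIdeal)
    (hμ : μ.IsUnramifiedAt w.1) (hμu : μ.IsUnitary)
    (hμω : ∀ x : ideleGroup ↥(maximalRealSubfield L), μ (AdeleRing.ideleBaseChange ↥(maximalRealSubfield L) L x) = quadraticHeckeCharCM L x)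
    (h2 : IsUnit (2 : 𝒪[w.1.adicCompletion L]))
    [MeasurableSpace ((cmDatum L 3 H').Local v)] [BorelSpace ((cmDatum L 3 H').Local v)]
    [∀ γ : ((cmDatum L 3 H').Local v), MeasurableSpace (((cmDatum L 3 H').Local v) ⧸ Subgroup.centralizer ({γ} : Set ((cmDatum L 3 H').Local v)))]
    [∀ γ : ((cmDatum L 3 H').Local v), BorelSpace (((cmDatum L 3 H').Local v) ⧸ Subgroup.centralizer ({γ} : Set ((cmDatum L 3 H').Local v)))]
    [MeasurableSpace ((cmDatum L 2 (Matrix.of fun i j : Fin 2 => if i.val + j.val + 1 = 2 then (1 : L) else 0)).Local v × (cmDatum L 1 (Matrix.of fun i j : Fin 1 => if i.val + j.val + 1 = 1 then (1 : L) else 0)).Local v)] [BorelSpace ((cmDatum L 2 (Matrix.of fun i j : Fin 2 => if i.val + j.val + 1 = 2 then (1 : L) else 0)).Local v × (cmDatum L 1 (Matrix.of fun i j : Fin 1 => if i.val + j.val + 1 = 1 then (1 : L) else 0)).Local v)]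
  [∀ a : (cmDatum L 2 (Matrix.of fun i j : Fin 2 => if i.val + j.val + 1 = 2 then (1 : L) else 0)).Local v × (cmDatum L 1 (Matrix.of fun i j : Fin 1 => if i.val + j.val + 1 = 1 then (1 : L) else 0)).Local v, MeasurableSpace (((cmDatum L 2 (Matrix.of fun i j : Fin 2 => if i.val + j.val + 1 = 2 then (1 : L) else 0)).Local v × (cmDatum L 1 (Matrix.of fun i j : Fin 1 => if i.val + j.val + 1 = 1 then (1 : L) else 0)).Local v) ⧸ Subgroup.centralizer ({a} : Set ((cmDatum L 2 (Matrix.of fun i j : Fin 2 => if i.val + j.val + 1 = 2 then (1 : L) else 0)).Local v × (cmDatum L 1 (Matrix.of fun i j : Fin 1 => if i.val + j.val + 1 = 1 then (1 : L) else 0)).Local v)))]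
  [∀ a : (cmDatum L 2 (Matrix.of fun i j : Fin 2 => if i.val + j.val + 1 = 2 then (1 : L) else 0)).Local v × (cmDatum L 1 (Matrix.of fun i j : Fin 1 => if i.val + j.val + 1 = 1 then (1 : L) else 0)).Local v, BorelSpace (((cmDatum L 2 (Matrix.of fun i j : Fin 2 => if i.val + j.val + 1 = 2 then (1 : L) else 0)).Local v × (cmDatum L 1 (Matrix.of fun i j : Fin 1 => if i.val + j.val + 1 = 1 then (1 : L) else 0)).Local v) ⧸ Subgroup.centralizer ({a} : Set ((cmDatum L 2 (Matrix.of fun i j : Fin 2 => if i.val + j.val + 1 = 2 then (1 : L) else 0)).Local v × (cmDatum L 1 (Matrix.of fun i j : Fin 1 => if i.val + j.val + 1 = 1 then (1 : L) else 0)).Local v)))]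
    (νH : Measure ((cmDatum L 2 (Matrix.of fun i j : Fin 2 => if i.val + j.val + 1 = 2 then (1 : L) else 0)).Local v × (cmDatum L 1 (Matrix.of fun i j : Fin 1 => if i.val + j.val + 1 = 1 then (1 : L) else 0)).Local v)) [νH.IsHaarMeasure] [νH.IsMulRightInvariant]
    (νG : Measure ((cmDatum L 3 H').Local v)) [νG.IsHaarMeasure] [νG.IsMulRightInvariant]
    {mH : OrbitalMeasureFamily ((cmDatum L 2 (Matrix.of fun i j : Fin 2 => if i.val + j.val + 1 = 2 then (1 : L) else 0)).Local v × (cmDatum L 1 (Matrix.of fun i j : Fin 1 => if i.val + j.val + 1 = 1 then (1 : L) else 0)).Local v)} {mG : OrbitalMeasureFamily ((cmDatum L 3 H').Local v)}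
    (hmH : mH.IsCanonical (IsLocalGRegular L v) νH)
    (hmG : mG.IsCanonical (fun γ => IsRegularElt (γ.val : GL (Fin 3) (UnitaryGroup.LocalRing L v))) νG)
    -- the frame: a local similitude `ᵗ(σT)·H′_v·T = a·Φ₃,v` (★ `exists_formCongr_map_eq_smul_antidiag_of_smul_eq`), `e := cmDatumLocalCongr L v T ha h`
    (T : GL (Fin 3) (UnitaryGroup.LocalRing L v)) {a : UnitaryGroup.LocalRing L v} (ha : IsUnit a)
    (haσ : UnitaryGroup.conjLocal L (IsCMField.complexConj L) v a = a)
    (h : formCongr (UnitaryGroup.conjLocal L (IsCMField.complexConj L) v) T (H'.map (algebraMap L (UnitaryGroup.LocalRing L v))) =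
      a • (Matrix.of fun i j : Fin 3 => if i.val + j.val + 1 = 3 then (1 : L) else 0).map (algebraMap L (UnitaryGroup.LocalRing L v)))
    -- the piece on `U(H′)_v`: `C_c^∞`, supported in the hyperspecial `e(K_std(Φ₃))`, `Ad e(K_std(Φ₃))`-invariant, left-invariant under `e` of the level-1 congruence set
    (g : ((cmDatum L 3 H').Local v) → ℂ) (hg : IsLocSmooth g)
    (hgK : ∀ y : (cmDatum L 3 (Matrix.of fun i j : Fin 3 => if i.val + j.val + 1 = 3 then (1 : L) else 0)).Local v,
      (UnitaryGroup.cmDatumLocalCongr L v T ha h) y ∈ tsupport g →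
        y ∈ cmLocalIntegralLevel L 3 (Matrix.of fun i j : Fin 3 => if i.val + j.val + 1 = 3 then (1 : L) else 0) v)
    (hginv : ∀ u ∈ cmLocalIntegralLevel L 3 (Matrix.of fun i j : Fin 3 => if i.val + j.val + 1 = 3 then (1 : L) else 0) v, ∀ x,
      g ((UnitaryGroup.cmDatumLocalCongr L v T ha h) u * x * ((UnitaryGroup.cmDatumLocalCongr L v T ha h) u)⁻¹) = g x)
    (hg1 : ∀ u : (cmDatum L 3 (Matrix.of fun i j : Fin 3 => if i.val + j.val + 1 = 3 then (1 : L) else 0)).Local v,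
      (∀ i j, Valued.v (((toPlace v w (HeckeCharacter.uniformizer ↥(maximalRealSubfield L) v : v.adicCompletion ↥(maximalRealSubfield L))) ^ 1)⁻¹ *
        ((((localNonsplitEquiv (IsCMField.complexConj L) (Matrix.of fun i j : Fin 3 => if i.val + j.val + 1 = 3 then (1 : L) else 0) (IsCMField.complexConj_ne_one L) w hw u :
            ↥(unitaryGroupOfForm (galAdicCompletionMap (L := L) (IsCMField.complexConj L) hw)
              (placeForm (Matrix.of fun i j : Fin 3 => if i.val + j.val + 1 = 3 then (1 : L) else 0) w.1))) : GL (Fin 3) (w.1.adicCompletion L)) :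
              Matrix (Fin 3) (Fin 3) (w.1.adicCompletion L)) i j - (1 : Matrix (Fin 3) (Fin 3) (w.1.adicCompletion L)) i j)) ≤ 1) →
      ∀ x, g ((UnitaryGroup.cmDatumLocalCongr L v T ha h) u * x) = g x) :
    ∃ V ∈ 𝓝 (1 : ((cmDatum L 2 (Matrix.of fun i j : Fin 2 => if i.val + j.val + 1 = 2 then (1 : L) else 0)).Local v × (cmDatum L 1 (Matrix.of fun i j : Fin 1 => if i.val + j.val + 1 = 1 then (1 : L) else 0)).Local v)), ∃ φH : ((cmDatum L 2 (Matrix.of fun i j : Fin 2 => if i.val + j.val + 1 = 2 then (1 : L) else 0)).Local v × (cmDatum L 1 (Matrix.of fun i j : Fin 1 => if i.val + j.val + 1 = 1 then (1 : L) else 0)).Local v) → ℂ, IsLocSmooth φH ∧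
      ∀ γH ∈ V, IsLocalGRegular L v γH →
        stableOrbitalIntegralRel (IsLocalStablyConjH L v) mH φH γH =
          ∑ᶠ c : ConjClasses ((cmDatum L 3 H').Local v),
            ((finExplicitCollection L H' μ (finExplicitDelta_conj_left_all L H' μ) (finExplicitDelta_conj_right_all L H' μ)) v).Δ γH (Quotient.out c) *
              classOrbitalIntegral mG g c := by
  -- Borel structures on the `Φ₃` side
  letI iM : MeasurableSpace ((cmDatum L 3 (Matrix.of fun i j : Fin 3 => if i.val + j.val + 1 = 3 then (1 : L) else 0)).Local v) := borel _
  haveI iB : BorelSpace ((cmDatum L 3 (Matrix.of fun i j : Fin 3 => if i.val + j.val + 1 = 3 then (1 : L) else 0)).Local v) := ⟨rfl⟩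
  letI iMq : ∀ γ : (cmDatum L 3 (Matrix.of fun i j : Fin 3 => if i.val + j.val + 1 = 3 then (1 : L) else 0)).Local v,
      MeasurableSpace ((cmDatum L 3 (Matrix.of fun i j : Fin 3 => if i.val + j.val + 1 = 3 then (1 : L) else 0)).Local v ⧸
        Subgroup.centralizer ({γ} : Set ((cmDatum L 3 (Matrix.of fun i j : Fin 3 => if i.val + j.val + 1 = 3 then (1 : L) else 0)).Local v))) :=
    fun _ => borel _
  haveI iBq : ∀ γ : (cmDatum L 3 (Matrix.of fun i j : Fin 3 => if i.val + j.val + 1 = 3 then (1 : L) else 0)).Local v,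
      BorelSpace ((cmDatum L 3 (Matrix.of fun i j : Fin 3 => if i.val + j.val + 1 = 3 then (1 : L) else 0)).Local v ⧸
        Subgroup.centralizer ({γ} : Set ((cmDatum L 3 (Matrix.of fun i j : Fin 3 => if i.val + j.val + 1 = 3 then (1 : L) else 0)).Local v))) :=
    fun _ => ⟨rfl⟩
  -- the transported Haar measure on `U(Φ₃)_v`
  haveI : (νG.map (UnitaryGroup.cmDatumLocalCongr L v T ha h).symm).IsMulRightInvariant :=
    Literature.MeasureTheory.Group.isMulRightInvariant_map_mulEquiv_of_isMulRightInvariant (UnitaryGroup.cmDatumLocalCongr L v T ha h).symm.toMulEquiv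
      (UnitaryGroup.cmDatumLocalCongr L v T ha h).symm.continuous.measurable νG
  -- class preservation along `e`: regularity transports, the canonical family transports
  have hcl' : ∀ γ : (cmDatum L 3 (Matrix.of fun i j : Fin 3 => if i.val + j.val + 1 = 3 then (1 : L) else 0)).Local v,
      Corresponds (UnitaryGroup.conjLocal L (IsCMField.complexConj L) v) ((UnitaryGroup.adelicForm L 3 H').map (UnitaryGroup.adeleToLocal L v))
        ((UnitaryGroup.adelicForm L 3 (Matrix.of fun i j : Fin 3 => if i.val + j.val + 1 = 3 then (1 : L) else 0)).map (UnitaryGroup.adeleToLocal L v))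
        ((UnitaryGroup.cmDatumLocalCongr L v T ha h) γ) γ :=
    fun γ => corresponds_comm.1 (corresponds_cmDatumLocalCongr L v T ha h γ)
  have hmGΦ : (mG.transport (UnitaryGroup.cmDatumLocalCongr L v T ha h).symm.toMulEquiv (UnitaryGroup.cmDatumLocalCongr L v T ha h).symm.continuous
      (UnitaryGroup.cmDatumLocalCongr L v T ha h).continuous).IsCanonical
        (fun γ => IsRegularElt (γ.val : GL (Fin 3) (UnitaryGroup.LocalRing L v))) (νG.map (UnitaryGroup.cmDatumLocalCongr L v T ha h).symm) :=
    hmG.transport (UnitaryGroup.cmDatumLocalCongr L v T ha h).symm.toMulEquiv (UnitaryGroup.cmDatumLocalCongr L v T ha h).symm.continuous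
      (UnitaryGroup.cmDatumLocalCongr L v T ha h).continuous (fun _ _ hbb' => isRegularElt_iff_of_isConj_local L H' v hbb')
      (fun γ hγ => isRegularElt_of_isConj (hcl' γ).symm hγ) νG (νG.map (UnitaryGroup.cmDatumLocalCongr L v T ha h).symm) rfl
  -- the piece `g ∘ e` on `U(Φ₃)_v` satisfies the head's hypotheses at `Φ₃`
  have hcont : Continuous fun x => (UnitaryGroup.cmDatumLocalCongr L v T ha h) x := (UnitaryGroup.cmDatumLocalCongr L v T ha h).continuous
  have hsm : IsLocSmooth (g ∘ (UnitaryGroup.cmDatumLocalCongr L v T ha h)) :=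
    ⟨hg.1.comp_continuous hcont, hg.2.comp_homeomorph (UnitaryGroup.cmDatumLocalCongr L v T ha h).toHomeomorph⟩
  have hsupp : tsupport (g ∘ (UnitaryGroup.cmDatumLocalCongr L v T ha h)) ⊆
      (cmLocalIntegralLevel L 3 (Matrix.of fun i j : Fin 3 => if i.val + j.val + 1 = 3 then (1 : L) else 0) v :
        Set ((cmDatum L 3 (Matrix.of fun i j : Fin 3 => if i.val + j.val + 1 = 3 then (1 : L) else 0)).Local v)) := by
    -- `tsupport (g ∘ e) ⊆ e⁻¹' (tsupport g)` (continuity of `e`), then `hgK` and `e⁻¹ (e y) = y`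
    have hsub : tsupport (g ∘ (UnitaryGroup.cmDatumLocalCongr L v T ha h)) ⊆ (fun x => (UnitaryGroup.cmDatumLocalCongr L v T ha h) x) ⁻¹' tsupport g := by
      rw [tsupport, tsupport, Function.support_comp_eq_preimage]
      exact hcont.closure_preimage_subset (Function.support g)
    intro y hy
    -- re-type through `Set.mem_preimage` (an `Iff.rfl` lemma) so that the kernel never compares `y` with `e y`
    have h1 : (fun x => (UnitaryGroup.cmDatumLocalCongr L v T ha h) x) y ∈ tsupport g := Set.mem_preimage.1 (hsub hy)
    exact hgK y h1
  have hinv : ∀ u ∈ cmLocalIntegralLevel L 3 (Matrix.of fun i j : Fin 3 => if i.val + j.val + 1 = 3 then (1 : L) else 0) v, ∀ x,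
      (g ∘ (UnitaryGroup.cmDatumLocalCongr L v T ha h)) (u * x * u⁻¹) = (g ∘ (UnitaryGroup.cmDatumLocalCongr L v T ha h)) x := by
    intro u hu x
    simp only [Function.comp_apply, map_mul, map_inv]
    exact hginv u hu _
  have hlvl : ∀ u : (cmDatum L 3 (Matrix.of fun i j : Fin 3 => if i.val + j.val + 1 = 3 then (1 : L) else 0)).Local v,
      (∀ i j, Valued.v (((toPlace v w (HeckeCharacter.uniformizer ↥(maximalRealSubfield L) v : v.adicCompletion ↥(maximalRealSubfield L))) ^ 1)⁻¹ *
        ((((localNonsplitEquiv (IsCMField.complexConj L) (Matrix.of fun i j : Fin 3 => if i.val + j.val + 1 = 3 then (1 : L) else 0) (IsCMField.complexConj_ne_one L) w hw u :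
            ↥(unitaryGroupOfForm (galAdicCompletionMap (L := L) (IsCMField.complexConj L) hw)
              (placeForm (Matrix.of fun i j : Fin 3 => if i.val + j.val + 1 = 3 then (1 : L) else 0) w.1))) : GL (Fin 3) (w.1.adicCompletion L)) :
              Matrix (Fin 3) (Fin 3) (w.1.adicCompletion L)) i j - (1 : Matrix (Fin 3) (Fin 3) (w.1.adicCompletion L)) i j)) ≤ 1) →
      ∀ x, (g ∘ (UnitaryGroup.cmDatumLocalCongr L v T ha h)) (u * x) = (g ∘ (UnitaryGroup.cmDatumLocalCongr L v T ha h)) x := by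
    intro u hu x
    simp only [Function.comp_apply, map_mul]
    exact hg1 u hu _
  -- the head at `Φ₃` (good reduction at every `w`), transported back along `e`
  have hΦ := localTransferAtOne_of_hyperspecialLevel_le_one L (Matrix.of fun i j : Fin 3 => if i.val + j.val + 1 = 3 then (1 : L) else 0) μ
    (antidiagOne_isHermitian L 3) w hw hv (isUnit_placeForm_antidiagOne 3 w.1) (unit_placeForm_antidiagOne_mem_glInt 3 w.1) hμ hμu hμω h2 νH
    (νG.map (UnitaryGroup.cmDatumLocalCongr L v T ha h).symm) hmH hmGΦ (g ∘ (UnitaryGroup.cmDatumLocalCongr L v T ha h)) hsm hsupp hinv hlvl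
  exact localTransferAtOne_transport_of_formCongr L v H' T ha h w hw hH' hdet haσ μ mH mG g hΦ

/-- **COROLLARY (A-85 (4) ∕ A-88 (1)): the waypoint head `…_le_two` HOLDS FOR EVERY `H′` at an unramified non-split `v ∤ 2` — bad reduction at `w` included —
for pieces on the hyperspecial `e(K_std(Φ₃))`**, `e = cmDatumLocalCongr … : U(Φ₃)_v ≃ₜ* U(H′)_v` the conjugation by a local similitude `ᵗ(σT)·H′_v·T = a·Φ₃,v` (★
`exists_formCongr_map_eq_smul_antidiag_of_smul_eq`): the good-reduction pair `hH′w hH′i` of the head is DROPPED (replaced by `hdet`), the piece hypotheses are the head's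
pulled back through `e`, the conclusion is the head's VERBATIM.  Proof: the head at `Φ₃` (good reduction at every `w`: ★ `isUnit_placeForm_antidiagOne`, ★
`unit_placeForm_antidiagOne_mem_glInt`) for the transported data `(e⁻¹_* ν_G, e⁻¹_* m_G, g ∘ e)` (canonical: ★ `transport_isCanonical_isRegularElt`), then ★
`localTransferAtOne_transport_of_formCongr`. [cite: Rogawski1990, §4.9 Prop. 4.9.1 p. 55; §14.4 p. 237] [cite: LanglandsShelstad1987, §4.2] -/
theorem localTransferAtOne_of_hyperspecialLevel_le_two_of_formCongr
    (L : Type) [Field L] [NumberField L] [IsCMField L] (H' : Matrix (Fin 3) (Fin 3) L) (μ : HeckeCharacter L)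
    {v : HeightOneSpectrum (𝓞 ↥(maximalRealSubfield L))}
    (hH' : (H'.map (cmConjRingHom L)).transpose = H') (hdet : H'.det ≠ 0) (w : PlacesOver L v)
    (hw : IsCMField.complexConj L • w.1 = w.1) (hv : Algebra.IsUnramifiedIn (𝓞 L) v.asIdeal)
    (hμ : μ.IsUnramifiedAt w.1) (hμu : μ.IsUnitary)
    (hμω : ∀ x : ideleGroup ↥(maximalRealSubfield L), μ (AdeleRing.ideleBaseChange ↥(maximalRealSubfield L) L x) = quadraticHeckeCharCM L x)
    (h2 : IsUnit (2 : 𝒪[w.1.adicCompletion L]))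
    [MeasurableSpace ((cmDatum L 3 H').Local v)] [BorelSpace ((cmDatum L 3 H').Local v)]
    [∀ γ : ((cmDatum L 3 H').Local v), MeasurableSpace (((cmDatum L 3 H').Local v) ⧸ Subgroup.centralizer ({γ} : Set ((cmDatum L 3 H').Local v)))]
    [∀ γ : ((cmDatum L 3 H').Local v), BorelSpace (((cmDatum L 3 H').Local v) ⧸ Subgroup.centralizer ({γ} : Set ((cmDatum L 3 H').Local v)))]
    [MeasurableSpace ((cmDatum L 2 (Matrix.of fun i j : Fin 2 => if i.val + j.val + 1 = 2 then (1 : L) else 0)).Local v × (cmDatum L 1 (Matrix.of fun i j : Fin 1 => if i.val + j.val + 1 = 1 then (1 : L) else 0)).Local v)] [BorelSpace ((cmDatum L 2 (Matrix.of fun i j : Fin 2 => if i.val + j.val + 1 = 2 then (1 : L) else 0)).Local v × (cmDatum L 1 (Matrix.of fun i j : Fin 1 => if i.val + j.val + 1 = 1 then (1 : L) else 0)).Local v)]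
  [∀ a : (cmDatum L 2 (Matrix.of fun i j : Fin 2 => if i.val + j.val + 1 = 2 then (1 : L) else 0)).Local v × (cmDatum L 1 (Matrix.of fun i j : Fin 1 => if i.val + j.val + 1 = 1 then (1 : L) else 0)).Local v, MeasurableSpace (((cmDatum L 2 (Matrix.of fun i j : Fin 2 => if i.val + j.val + 1 = 2 then (1 : L) else 0)).Local v × (cmDatum L 1 (Matrix.of fun i j : Fin 1 => if i.val + j.val + 1 = 1 then (1 : L) else 0)).Local v) ⧸ Subgroup.centralizer ({a} : Set ((cmDatum L 2 (Matrix.of fun i j : Fin 2 => if i.val + j.val + 1 = 2 then (1 : L) else 0)).Local v × (cmDatum L 1 (Matrix.of fun i j : Fin 1 => if i.val + j.val + 1 = 1 then (1 : L) else 0)).Local v)))]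
  [∀ a : (cmDatum L 2 (Matrix.of fun i j : Fin 2 => if i.val + j.val + 1 = 2 then (1 : L) else 0)).Local v × (cmDatum L 1 (Matrix.of fun i j : Fin 1 => if i.val + j.val + 1 = 1 then (1 : L) else 0)).Local v, BorelSpace (((cmDatum L 2 (Matrix.of fun i j : Fin 2 => if i.val + j.val + 1 = 2 then (1 : L) else 0)).Local v × (cmDatum L 1 (Matrix.of fun i j : Fin 1 => if i.val + j.val + 1 = 1 then (1 : L) else 0)).Local v) ⧸ Subgroup.centralizer ({a} : Set ((cmDatum L 2 (Matrix.of fun i j : Fin 2 => if i.val + j.val + 1 = 2 then (1 : L) else 0)).Local v × (cmDatum L 1 (Matrix.of fun i j : Fin 1 => if i.val + j.val + 1 = 1 then (1 : L) else 0)).Local v)))]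
    (νH : Measure ((cmDatum L 2 (Matrix.of fun i j : Fin 2 => if i.val + j.val + 1 = 2 then (1 : L) else 0)).Local v × (cmDatum L 1 (Matrix.of fun i j : Fin 1 => if i.val + j.val + 1 = 1 then (1 : L) else 0)).Local v)) [νH.IsHaarMeasure] [νH.IsMulRightInvariant]
    (νG : Measure ((cmDatum L 3 H').Local v)) [νG.IsHaarMeasure] [νG.IsMulRightInvariant]
    {mH : OrbitalMeasureFamily ((cmDatum L 2 (Matrix.of fun i j : Fin 2 => if i.val + j.val + 1 = 2 then (1 : L) else 0)).Local v × (cmDatum L 1 (Matrix.of fun i j : Fin 1 => if i.val + j.val + 1 = 1 then (1 : L) else 0)).Local v)} {mG : OrbitalMeasureFamily ((cmDatum L 3 H').Local v)}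
    (hmH : mH.IsCanonical (IsLocalGRegular L v) νH)
    (hmG : mG.IsCanonical (fun γ => IsRegularElt (γ.val : GL (Fin 3) (UnitaryGroup.LocalRing L v))) νG)
    -- the frame: a local similitude `ᵗ(σT)·H′_v·T = a·Φ₃,v` (★ `exists_formCongr_map_eq_smul_antidiag_of_smul_eq`), `e := cmDatumLocalCongr L v T ha h`
    (T : GL (Fin 3) (UnitaryGroup.LocalRing L v)) {a : UnitaryGroup.LocalRing L v} (ha : IsUnit a)
    (haσ : UnitaryGroup.conjLocal L (IsCMField.complexConj L) v a = a)
    (h : formCongr (UnitaryGroup.conjLocal L (IsCMField.complexConj L) v) T (H'.map (algebraMap L (UnitaryGroup.LocalRing L v))) =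
      a • (Matrix.of fun i j : Fin 3 => if i.val + j.val + 1 = 3 then (1 : L) else 0).map (algebraMap L (UnitaryGroup.LocalRing L v)))
    -- the piece on `U(H′)_v`: `C_c^∞`, supported in the hyperspecial `e(K_std(Φ₃))`, `Ad e(K_std(Φ₃))`-invariant, left-invariant under `e` of the level-2 congruence set
    (g : ((cmDatum L 3 H').Local v) → ℂ) (hg : IsLocSmooth g)
    (hgK : ∀ y : (cmDatum L 3 (Matrix.of fun i j : Fin 3 => if i.val + j.val + 1 = 3 then (1 : L) else 0)).Local v,
      (UnitaryGroup.cmDatumLocalCongr L v T ha h) y ∈ tsupport g →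
        y ∈ cmLocalIntegralLevel L 3 (Matrix.of fun i j : Fin 3 => if i.val + j.val + 1 = 3 then (1 : L) else 0) v)
    (hginv : ∀ u ∈ cmLocalIntegralLevel L 3 (Matrix.of fun i j : Fin 3 => if i.val + j.val + 1 = 3 then (1 : L) else 0) v, ∀ x,
      g ((UnitaryGroup.cmDatumLocalCongr L v T ha h) u * x * ((UnitaryGroup.cmDatumLocalCongr L v T ha h) u)⁻¹) = g x)
    (hg2 : ∀ u : (cmDatum L 3 (Matrix.of fun i j : Fin 3 => if i.val + j.val + 1 = 3 then (1 : L) else 0)).Local v,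
      (∀ i j, Valued.v (((toPlace v w (HeckeCharacter.uniformizer ↥(maximalRealSubfield L) v : v.adicCompletion ↥(maximalRealSubfield L))) ^ 2)⁻¹ *
        ((((localNonsplitEquiv (IsCMField.complexConj L) (Matrix.of fun i j : Fin 3 => if i.val + j.val + 1 = 3 then (1 : L) else 0) (IsCMField.complexConj_ne_one L) w hw u :
            ↥(unitaryGroupOfForm (galAdicCompletionMap (L := L) (IsCMField.complexConj L) hw)
              (placeForm (Matrix.of fun i j : Fin 3 => if i.val + j.val + 1 = 3 then (1 : L) else 0) w.1))) : GL (Fin 3) (w.1.adicCompletion L)) :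
              Matrix (Fin 3) (Fin 3) (w.1.adicCompletion L)) i j - (1 : Matrix (Fin 3) (Fin 3) (w.1.adicCompletion L)) i j)) ≤ 1) →
      ∀ x, g ((UnitaryGroup.cmDatumLocalCongr L v T ha h) u * x) = g x) :
    ∃ V ∈ 𝓝 (1 : ((cmDatum L 2 (Matrix.of fun i j : Fin 2 => if i.val + j.val + 1 = 2 then (1 : L) else 0)).Local v × (cmDatum L 1 (Matrix.of fun i j : Fin 1 => if i.val + j.val + 1 = 1 then (1 : L) else 0)).Local v)), ∃ φH : ((cmDatum L 2 (Matrix.of fun i j : Fin 2 => if i.val + j.val + 1 = 2 then (1 : L) else 0)).Local v × (cmDatum L 1 (Matrix.of fun i j : Fin 1 => if i.val + j.val + 1 = 1 then (1 : L) else 0)).Local v) → ℂ, IsLocSmooth φH ∧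
      ∀ γH ∈ V, IsLocalGRegular L v γH →
        stableOrbitalIntegralRel (IsLocalStablyConjH L v) mH φH γH =
          ∑ᶠ c : ConjClasses ((cmDatum L 3 H').Local v),
            ((finExplicitCollection L H' μ (finExplicitDelta_conj_left_all L H' μ) (finExplicitDelta_conj_right_all L H' μ)) v).Δ γH (Quotient.out c) *
              classOrbitalIntegral mG g c := by
  -- Borel structures on the `Φ₃` side
  letI iM : MeasurableSpace ((cmDatum L 3 (Matrix.of fun i j : Fin 3 => if i.val + j.val + 1 = 3 then (1 : L) else 0)).Local v) := borel _
  haveI iB : BorelSpace ((cmDatum L 3 (Matrix.of fun i j : Fin 3 => if i.val + j.val + 1 = 3 then (1 : L) else 0)).Local v) := ⟨rfl⟩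
  letI iMq : ∀ γ : (cmDatum L 3 (Matrix.of fun i j : Fin 3 => if i.val + j.val + 1 = 3 then (1 : L) else 0)).Local v,
      MeasurableSpace ((cmDatum L 3 (Matrix.of fun i j : Fin 3 => if i.val + j.val + 1 = 3 then (1 : L) else 0)).Local v ⧸
        Subgroup.centralizer ({γ} : Set ((cmDatum L 3 (Matrix.of fun i j : Fin 3 => if i.val + j.val + 1 = 3 then (1 : L) else 0)).Local v))) :=
    fun _ => borel _
  haveI iBq : ∀ γ : (cmDatum L 3 (Matrix.of fun i j : Fin 3 => if i.val + j.val + 1 = 3 then (1 : L) else 0)).Local v,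
      BorelSpace ((cmDatum L 3 (Matrix.of fun i j : Fin 3 => if i.val + j.val + 1 = 3 then (1 : L) else 0)).Local v ⧸
        Subgroup.centralizer ({γ} : Set ((cmDatum L 3 (Matrix.of fun i j : Fin 3 => if i.val + j.val + 1 = 3 then (1 : L) else 0)).Local v))) :=
    fun _ => ⟨rfl⟩
  -- the transported Haar measure on `U(Φ₃)_v`
  haveI : (νG.map (UnitaryGroup.cmDatumLocalCongr L v T ha h).symm).IsMulRightInvariant :=
    Literature.MeasureTheory.Group.isMulRightInvariant_map_mulEquiv_of_isMulRightInvariant (UnitaryGroup.cmDatumLocalCongr L v T ha h).symm.toMulEquiv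
      (UnitaryGroup.cmDatumLocalCongr L v T ha h).symm.continuous.measurable νG
  -- class preservation along `e`: regularity transports, the canonical family transports
  have hcl' : ∀ γ : (cmDatum L 3 (Matrix.of fun i j : Fin 3 => if i.val + j.val + 1 = 3 then (1 : L) else 0)).Local v,
      Corresponds (UnitaryGroup.conjLocal L (IsCMField.complexConj L) v) ((UnitaryGroup.adelicForm L 3 H').map (UnitaryGroup.adeleToLocal L v))
        ((UnitaryGroup.adelicForm L 3 (Matrix.of fun i j : Fin 3 => if i.val + j.val + 1 = 3 then (1 : L) else 0)).map (UnitaryGroup.adeleToLocal L v))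
        ((UnitaryGroup.cmDatumLocalCongr L v T ha h) γ) γ :=
    fun γ => corresponds_comm.1 (corresponds_cmDatumLocalCongr L v T ha h γ)
  have hmGΦ : (mG.transport (UnitaryGroup.cmDatumLocalCongr L v T ha h).symm.toMulEquiv (UnitaryGroup.cmDatumLocalCongr L v T ha h).symm.continuous
      (UnitaryGroup.cmDatumLocalCongr L v T ha h).continuous).IsCanonical
        (fun γ => IsRegularElt (γ.val : GL (Fin 3) (UnitaryGroup.LocalRing L v))) (νG.map (UnitaryGroup.cmDatumLocalCongr L v T ha h).symm) :=
    hmG.transport (UnitaryGroup.cmDatumLocalCongr L v T ha h).symm.toMulEquiv (UnitaryGroup.cmDatumLocalCongr L v T ha h).symm.continuous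
      (UnitaryGroup.cmDatumLocalCongr L v T ha h).continuous (fun _ _ hbb' => isRegularElt_iff_of_isConj_local L H' v hbb')
      (fun γ hγ => isRegularElt_of_isConj (hcl' γ).symm hγ) νG (νG.map (UnitaryGroup.cmDatumLocalCongr L v T ha h).symm) rfl
  -- the piece `g ∘ e` on `U(Φ₃)_v` satisfies the head's hypotheses at `Φ₃`
  have hcont : Continuous fun x => (UnitaryGroup.cmDatumLocalCongr L v T ha h) x := (UnitaryGroup.cmDatumLocalCongr L v T ha h).continuous
  have hsm : IsLocSmooth (g ∘ (UnitaryGroup.cmDatumLocalCongr L v T ha h)) :=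
    ⟨hg.1.comp_continuous hcont, hg.2.comp_homeomorph (UnitaryGroup.cmDatumLocalCongr L v T ha h).toHomeomorph⟩
  have hsupp : tsupport (g ∘ (UnitaryGroup.cmDatumLocalCongr L v T ha h)) ⊆
      (cmLocalIntegralLevel L 3 (Matrix.of fun i j : Fin 3 => if i.val + j.val + 1 = 3 then (1 : L) else 0) v :
        Set ((cmDatum L 3 (Matrix.of fun i j : Fin 3 => if i.val + j.val + 1 = 3 then (1 : L) else 0)).Local v)) := by
    -- `tsupport (g ∘ e) ⊆ e⁻¹' (tsupport g)` (continuity of `e`), then `hgK` and `e⁻¹ (e y) = y`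
    have hsub : tsupport (g ∘ (UnitaryGroup.cmDatumLocalCongr L v T ha h)) ⊆ (fun x => (UnitaryGroup.cmDatumLocalCongr L v T ha h) x) ⁻¹' tsupport g := by
      rw [tsupport, tsupport, Function.support_comp_eq_preimage]
      exact hcont.closure_preimage_subset (Function.support g)
    intro y hy
    -- re-type through `Set.mem_preimage` (an `Iff.rfl` lemma) so that the kernel never compares `y` with `e y`
    have h1 : (fun x => (UnitaryGroup.cmDatumLocalCongr L v T ha h) x) y ∈ tsupport g := Set.mem_preimage.1 (hsub hy)
    exact hgK y h1
  have hinv : ∀ u ∈ cmLocalIntegralLevel L 3 (Matrix.of fun i j : Fin 3 => if i.val + j.val + 1 = 3 then (1 : L) else 0) v, ∀ x,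
      (g ∘ (UnitaryGroup.cmDatumLocalCongr L v T ha h)) (u * x * u⁻¹) = (g ∘ (UnitaryGroup.cmDatumLocalCongr L v T ha h)) x := by
    intro u hu x
    simp only [Function.comp_apply, map_mul, map_inv]
    exact hginv u hu _
  have hlvl : ∀ u : (cmDatum L 3 (Matrix.of fun i j : Fin 3 => if i.val + j.val + 1 = 3 then (1 : L) else 0)).Local v,
      (∀ i j, Valued.v (((toPlace v w (HeckeCharacter.uniformizer ↥(maximalRealSubfield L) v : v.adicCompletion ↥(maximalRealSubfield L))) ^ 2)⁻¹ *
        ((((localNonsplitEquiv (IsCMField.complexConj L) (Matrix.of fun i j : Fin 3 => if i.val + j.val + 1 = 3 then (1 : L) else 0) (IsCMField.complexConj_ne_one L) w hw u :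
            ↥(unitaryGroupOfForm (galAdicCompletionMap (L := L) (IsCMField.complexConj L) hw)
              (placeForm (Matrix.of fun i j : Fin 3 => if i.val + j.val + 1 = 3 then (1 : L) else 0) w.1))) : GL (Fin 3) (w.1.adicCompletion L)) :
              Matrix (Fin 3) (Fin 3) (w.1.adicCompletion L)) i j - (1 : Matrix (Fin 3) (Fin 3) (w.1.adicCompletion L)) i j)) ≤ 1) →
      ∀ x, (g ∘ (UnitaryGroup.cmDatumLocalCongr L v T ha h)) (u * x) = (g ∘ (UnitaryGroup.cmDatumLocalCongr L v T ha h)) x := by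
    intro u hu x
    simp only [Function.comp_apply, map_mul]
    exact hg2 u hu _
  -- the head at `Φ₃` (good reduction at every `w`), transported back along `e`
  have hΦ := localTransferAtOne_of_hyperspecialLevel_le_two L (Matrix.of fun i j : Fin 3 => if i.val + j.val + 1 = 3 then (1 : L) else 0) μ
    (antidiagOne_isHermitian L 3) w hw hv (isUnit_placeForm_antidiagOne 3 w.1) (unit_placeForm_antidiagOne_mem_glInt 3 w.1) hμ hμu hμω h2 νH
    (νG.map (UnitaryGroup.cmDatumLocalCongr L v T ha h).symm) hmH hmGΦ (g ∘ (UnitaryGroup.cmDatumLocalCongr L v T ha h)) hsm hsupp hinv hlvl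
  exact localTransferAtOne_transport_of_formCongr L v H' T ha h w hw hH' hdet haσ μ mH mG g hΦ

end Literature.NumberTheory.Rogawski1990

end
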